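import Literature.AlgebraicGeometry.Motives.HodgeThetaSubalgebraUnitaryTenNineteenCore
import HarnessLib

/-!
# The `Θ`-subalgebra theorem for unitary multiplicities `(12, 19)` REDUCED to the constant-rank-`9` configuration
# (Ribet 1983 Thm. 3, Lie step; abelian 31-folds of type `(12, 19)` — a partial, unconditional result)

Family `hodge`, layer `Literature/AlgebraicGeometry/Motives` (pure linear algebra over `ℂ`; no geometry). Research
context: cell `pub-hodge-ring2` (HONEST FRAMING: research route conditional on HC_CM; not a corollary; Q11.4-sentence-2
already refuted in dim ≥ 3), Literature lane gen 86, programme R74. UNCONDITIONAL; theorems only, no definition, no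
named fact (D-0026), no `sorry`. HONEST SCOPE: this file does NOT close the cell `(12, 19)`; it proves that a
counterexample would have ALL its non-zero raising operators of rank EXACTLY `9` (README §«THE ONE REMAINING PROBLEM»:
at a rank-`9` base point the Levi pair then has constant raising ranks `3` on type `(3|9)` and `6` on type `(9|10)`,
configurations with genuine local models).

THE ARGUMENT (`UnitaryTwelveNineteen.eq_top_of_smul_of_rank_ne_nine`). Ranks `1, …, 8, 11, 12` are good (larger-side
Levi types `(1|18)`, …, `(8|11)`, `(11|8)` (`UnitaryEight.eq_top_of_smul'`), `(12|7)` (`UnitarySeven.eq_top_of_smul'`)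
are tree cores), so if `𝔊 ≠ End(W)` then `S ⊆ {0, 9, 10}`; and `10 ∉ S` (**`no_rank_ten`**): at `r = 10` (maximal),
`U⁺` of type `(2|10)`, `U⁻` of type `(10|9)`; `i = 1` is killed (`UnitaryRankOneRaise.eq_top_of_rankOne_raise_two`,
then `UnitaryLeviFull.exists_rankOne_raise_of_maxRank`), `j ∈ {1, 3, 7, 9}` by the mirrored inner double Levi in `L⁻`
(cores `(3|7)`, `(7|3)`, `(9|1)` and `UnitaryRankOneRaise.eq_top_of_rankOne_raise`); the profiles are `(0,0)` and
`(2,8)`, so the raising elements of `L⁻` (type `(10|9)`) have constant rank `8` — excluded by TOOL F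
(`UnitaryConstantRank.false_of_le_rank`: `(10 − 8) + (9 − 8) = 3 < 8`). Hence a non-zero raising operator of rank `≠ 9`
forces `𝔊 = End(W)`; **`eq_top_of_smul_of_rank_ne_nine'`** is the mirror `(19, 12)`.

## References
* [Ribet1983] K. A. Ribet, *Hodge classes on certain types of abelian varieties*, Amer. J. Math. 105 (1983), Thm. 3.
* [Gordon1997] B. B. Gordon, *A survey of the Hodge conjecture for abelian varieties*, Thm. 6.3 (3), pp. 18–19.
* [Deligne1982HodgeCycles] P. Deligne, *Hodge cycles on abelian varieties*, LNM 900 (1982), I §3 Prop. 3.4, 3.6.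
* [GoodmanWallachGTM255] R. Goodman, N. R. Wallach, GTM 255 (2009), §4.1.1.
* [HoffmanKunze1971LinearAlgebra] K. Hoffman, R. Kunze, *Linear Algebra* (1971), §3.1 Thm. 2, §6.7, §8.3.
-/

noncomputable section

open Module

namespace Literature.AlgebraicGeometry.Motives

namespace HodgeStructure

universe u

variable {W : Type u} [AddCommGroup W] [Module ℂ W]

/-- (Step) If every raising operator of a unitary algebra of type `(12 | 19)` has rank in `{0, 9, 10}`, none has rank
`10` (module docstring: the Levi algebra `L⁻` of type `(10|9)` would have constant raising rank `8`, TOOL F).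
[cite: Ribet1983, Thm. 3] [cite: Gordon1997, Thm. 6.3 (3)] [cite: GoodmanWallachGTM255, §4.1.1] -/
theorem UnitaryTwelveNineteen.no_rank_ten [FiniteDimensional ℂ W] {𝔊 : Submodule ℂ (Module.End ℂ W)}
    (hbr : ∀ Y ∈ 𝔊, ∀ Z ∈ 𝔊, Y * Z - Z * Y ∈ 𝔊)
    (hirr : ∀ U : Submodule ℂ W, (∀ A ∈ 𝔊, ∀ u ∈ U, A u ∈ U) → U = ⊥ ∨ U = ⊤)
    {Θ : Module.End ℂ W} (hΘ : Θ ∈ 𝔊) (hΘΘ : Θ * Θ = 1)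
    {P Q : Submodule ℂ W} (hP : ∀ x, x ∈ P ↔ Θ x = x) (hQ : ∀ x, x ∈ Q ↔ Θ x = -x)
    (hP12 : Module.finrank ℂ P = 12) (hQ19 : Module.finrank ℂ Q = 19)
    {s : W → W → ℂ} (hadd : ∀ x y z, s (x + y) z = s x z + s y z)
    (hsymm : ∀ x y, s y x = starRingEnd ℂ (s x y))
    (hPQ : ∀ p ∈ P, ∀ q ∈ Q, s p q = 0) (hdefP : ∀ p ∈ P, s p p = 0 → p = 0) (hdefQ : ∀ q ∈ Q, s q q = 0 → q = 0)
    (hadj : ∀ X ∈ 𝔊, ∃ Y ∈ 𝔊, ∀ x y, s (X x) y = s x (Y y))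
    (hS : ∀ B' ∈ 𝔊, Θ * B' = B' → B' * Θ = -B' →
      Module.finrank ℂ (LinearMap.range B') = 0 ∨ Module.finrank ℂ (LinearMap.range B') = 9 ∨
        Module.finrank ℂ (LinearMap.range B') = 10)
    {B : Module.End ℂ W} (hB : B ∈ 𝔊) (hΘB : Θ * B = B) (hBΘ : B * Θ = -B)
    (h10 : Module.finrank ℂ (LinearMap.range B) = 10) : False := by
  classical
  have hsU : ∀ U : Submodule ℂ W, ∀ x y z : U, s ((x + y : U) : W) z = s (x : W) z + s (y : W) z :=
    fun U x y z => by simp only [Submodule.coe_add, hadd]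
  have hno1 : ∀ B' ∈ 𝔊, Θ * B' = B' → B' * Θ = -B' → Module.finrank ℂ (LinearMap.range B') ≠ 1 := by
    intro B' hB' hΘB' hB'Θ h1
    rcases hS B' hB' hΘB' hB'Θ with h | h | h <;> omega
  have hmax : ∀ B' ∈ 𝔊, Θ * B' = B' → B' * Θ = -B' →
      Module.finrank ℂ (LinearMap.range B') ≤ Module.finrank ℂ (LinearMap.range B) := by
    intro B' hB' hΘB' hB'Θ
    rcases hS B' hB' hΘB' hB'Θ with h | h | h <;> omega
  obtain ⟨ι, Um, Up, PU, QU, Lm, ιm, Pm, Qm, Lp, ιp, Pp, Qp, hιmem, hιι, hιΘ, hιs, hUm, hUp, hfinUm, hfinUp,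
    hPM, hQM, hPU, hQU, hrangeP, hPUP, hQUQ, hfinQM, hfinPU, hfinQU, hLm, hLp,
    hιmapply, hPmmem, hQmmem, hbrLm, hirrLm, hιmmem, hιmιm, hPm, hQm, hfinPm, hfinQm, hPmQm, hdefPm, hdefQm, hadjLm,
    hιpapply, hPpmem, hQpmem, hbrLp, hirrLp, hιpmem, hιpιp, hPp, hQp, hfinPp, hfinQp, hPpQp, hdefPp, hdefQp, hadjLp,
    hsplit⟩ :=
    UnitaryLeviSetup.exists_levi_pair hbr hirr hΘ hΘΘ hP hQ hadd hsymm hPQ hdefP hdefQ hadj hB hΘB hBΘ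
  rw [h10] at hfinQM hfinPU hfinQU hfinPm hfinQm hfinPp hfinQp hsplit
  rw [hQ19] at hfinQM hfinQm hfinUm
  rw [hP12] at hfinPU hfinPp hfinUp
  have hcm : ∀ Z : Module.End ℂ W, Z * ι = ι * Z → ∀ x ∈ Um, Z x ∈ Um := fun Z hZ x hx =>
    (hUm _).2 (by rw [← Module.End.mul_apply, ← hZ, Module.End.mul_apply, (hUm x).1 hx, map_neg])
  have hcp : ∀ Z : Module.End ℂ W, Z * ι = ι * Z → ∀ x ∈ Up, Z x ∈ Up := fun Z hZ x hx =>
    (hUp _).2 (by rw [← Module.End.mul_apply, ← hZ, Module.End.mul_apply, (hUp x).1 hx])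
  have hfullm_of : Lm = ⊤ → False := fun h =>
    UnitaryLeviSetup.false_of_full_larger hbr hΘΘ hno1 hιι hιΘ hUm hUp (by omega) (by omega) hPM hQM (by omega)
      (by omega) hLm h
  -- a full `L⁺` is impossible (`B` has maximal rank)
  have hfullp_of : Lp = ⊤ → False := by
    intro hLptop
    have hfullp : ∀ T : Module.End ℂ Up, ∃ Z ∈ 𝔊, Z * ι = ι * Z ∧ ∀ v : Up, ((T v : Up) : W) = Z v := fun T =>
      (hLp T).1 (by rw [hLptop]; exact Submodule.mem_top)
    obtain ⟨e₁, he₁, e₂, he₂, he₁0, he₂1⟩ := UnitaryPencil.exists_pair_of_two_le_finrank PU (by omega)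
    have hind : ∀ a b : ℂ, a • e₁ + b • e₂ = 0 → a = 0 ∧ b = 0 := by
      intro a b hab
      by_cases hb : b = 0
      · rw [hb, zero_smul, add_zero] at hab
        exact ⟨(smul_eq_zero.1 hab).resolve_right he₁0, hb⟩
      · exfalso
        apply he₂1
        rw [Submodule.mem_span_singleton]
        refine ⟨-(b⁻¹ * a), ?_⟩
        have : e₂ = b⁻¹ • (b • e₂) := by rw [smul_smul, inv_mul_cancel₀ hb, one_smul]
        rw [this, eq_neg_of_add_eq_zero_right hab]
        module
    obtain ⟨⟨c₁, hc₁⟩, hc₁0⟩ := Module.finrank_pos_iff_exists_ne_zero.1 (show 0 < Module.finrank ℂ QU by omega)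
    obtain ⟨B₁, hB₁, hΘB₁, hB₁Θ, hr1⟩ := UnitaryLeviFull.exists_rankOne_raise_of_maxRank hbr hΘ hΘΘ hB hΘB hBΘ hmax hιι
      hιΘ (fun w => ((hPM _).1 (LinearMap.mem_range_self B w)).1)
      (fun v hιv hΘv => LinearMap.mem_ker.1 (Submodule.mem_inf.1 ((hQM v).2 ⟨hιv, hΘv⟩)).2)
      (fun v hΘv hBv => ((hQM v).1 (Submodule.mem_inf.2 ⟨(hQ v).2 hΘv, LinearMap.mem_ker.2 hBv⟩)).1) hUp hfullp
      ((hPU e₁).1 he₁).2 ((hPU e₁).1 he₁).1 ((hPU e₂).1 he₂).2 ((hPU e₂).1 he₂).1 hind ((hQU c₁).1 hc₁).2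
      ((hQU c₁).1 hc₁).1 (fun h => hc₁0 (Subtype.ext h))
    exact hno1 B₁ hB₁ hΘB₁ hB₁Θ hr1
  -- `i ≠ 1` (`L⁺` of type `(2 | 10)` would be full)
  have hkillp1 : ∀ X ∈ 𝔊, Θ * X = X → X * Θ = -X → X * ι = ι * X → Module.finrank ℂ (Up.map X) ≠ 1 := by
    intro X hX hΘX hXΘ hXc h1
    obtain ⟨hymem, hιpy, hyιp, hyrk⟩ := UnitaryLeviSetup.restrict_mem hcp hLp hιpapply X hX hΘX hXΘ hXc
    rw [h1] at hyrk
    exact hfullp_of (UnitaryRankOneRaise.eq_top_of_rankOne_raise_two hbrLp hirrLp hιpmem hιpιp hPp hQp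
      (s := fun v w : Up => s (v : W) w) (hsU Up) (fun v w => hsymm v w) hPpQp hdefPp hdefQp hadjLp hymem hιpy hyιp
      hyrk (by omega) (by omega))
  -- `j ∉ {1, 3, 7, 9}`: rank one, and the mirrored inner double Levi in `L⁻` (type `(10 | 9)`)
  have hkillm : ∀ X ∈ 𝔊, Θ * X = X → X * Θ = -X → X * ι = ι * X →
      Module.finrank ℂ (Um.map X) ≠ 1 ∧ Module.finrank ℂ (Um.map X) ≠ 3 ∧ Module.finrank ℂ (Um.map X) ≠ 7 ∧
        Module.finrank ℂ (Um.map X) ≠ 9 := by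
    intro X hX hΘX hXΘ hXc
    obtain ⟨hxmem, hιmx, hxιm, hxrk⟩ := UnitaryLeviSetup.restrict_mem hcm hLm hιmapply X hX hΘX hXΘ hXc
    have hk1 : Module.finrank ℂ (Um.map X) = 1 → False := fun hj => by
      rw [hj] at hxrk
      exact hfullm_of (UnitaryRankOneRaise.eq_top_of_rankOne_raise hbrLm hirrLm hιmmem hιmιm hPm hQm
        (s := fun v w : Um => s (v : W) w) (hsU Um) (fun v w => hsymm v w) hPmQm hdefPm hdefQm hadjLm hxmem hιmx hxιm
        hxrk (by omega) (by omega) (by omega))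
    have hk : ∀ j, Module.finrank ℂ (Um.map X) = j → (j = 3 ∨ j = 7 ∨ j = 9) → False := by
      intro j hj hjs
      rw [hj] at hxrk
      refine hfullm_of (UnitaryDoubleLevi.eq_top_of_raise_of_core' hbrLm hirrLm hιmmem hιmιm hPm hQm
        (s := fun v w : Um => s (v : W) w) (hsU Um) (fun v w => hsymm v w) hPmQm hdefPm hdefQm hadjLm hxmem hιmx hxιm
        (by rw [hxrk]; omega) (by omega) (by omega)
        fun U' 𝔩' ι' P' Q' hbr𝔩' hirr𝔩' hι' hι'ι' hP' hQ' hfinP' hfinQ' hP'Q' hdefP' hdefQ' hadj𝔩' => ?_)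
      rw [hxrk] at hfinP' hfinQ'
      rw [hfinPm] at hfinQ'
      rcases hjs with rfl | rfl | rfl
      · -- `(3 | 7)`
        exact UnitaryThreeCoprime.eq_top hbr𝔩' hirr𝔩' hι' hι'ι' hP' hQ' hfinP' (by omega)
          (s := fun v w : U' => s ((v : Um) : W) w) (fun v w z => by simp only [Submodule.coe_add, hadd])
          (fun v w => hsymm _ _) hP'Q' hdefP' hdefQ' hadj𝔩'
      · -- `(7 | 3)`
        exact UnitaryThreeCoprime.eq_top' hbr𝔩' hirr𝔩' hι' hι'ι' hP' hQ' (by omega) (by omega)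
          (s := fun v w : U' => s ((v : Um) : W) w) (fun v w z => by simp only [Submodule.coe_add, hadd])
          (fun v w => hsymm _ _) hP'Q' hdefP' hdefQ' hadj𝔩'
      · -- `(9 | 1)`
        exact UnitaryThreeCoprime.eq_top_of_finrank_eq_one hbr𝔩' hirr𝔩' hι' hι'ι' hP' hQ' (by omega) (by omega)
    exact ⟨hk1, fun h => hk 3 h (by omega), fun h => hk 7 h (by omega), fun h => hk 9 h (by omega)⟩
  -- the profiles are `(0, 0)` and `(2, 8)`
  have hprof : ∀ X ∈ 𝔊, Θ * X = X → X * Θ = -X → X * ι = ι * X →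
      (Module.finrank ℂ (Up.map X) = 0 ∧ Module.finrank ℂ (Um.map X) = 0) ∨
        (Module.finrank ℂ (Up.map X) = 2 ∧ Module.finrank ℂ (Um.map X) = 8) := by
    intro X hX hΘX hXΘ hXc
    obtain ⟨hs, hi, -, -, hj⟩ := hsplit X hΘX hXΘ hXc
    have h1 := hkillp1 X hX hΘX hXΘ hXc
    obtain ⟨hm1, hm3, hm7, hm9⟩ := hkillm X hX hΘX hXΘ hXc
    have hr := hS X hX hΘX hXΘ
    rw [hs] at hr
    omega
  -- some `X₀` has profile `(2, 8)`; TOOL F inside `L⁻` (type `(10 | 9)`, constant rank `8`)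
  obtain ⟨⟨p, hp⟩, hp0⟩ := Module.finrank_pos_iff_exists_ne_zero.1 (show 0 < Module.finrank ℂ PU by omega)
  obtain ⟨⟨q, hq⟩, hq0⟩ := Module.finrank_pos_iff_exists_ne_zero.1 (show 0 < Module.finrank ℂ QU by omega)
  obtain ⟨X₀, hX₀, hΘX₀, hX₀Θ, hX₀c, c, hιc, hΘc, hX₀c0⟩ :=
    UnitaryLeviFull.exists_raise_commute_apply_ne_zero hbr hirr hΘ hΘΘ hQ hιmem hιι hιΘ hUm hUp
      ⟨p, fun h => hp0 (Subtype.ext h), ((hPU p).1 hp).1, ((hPU p).1 hp).2⟩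
      ⟨q, fun h => hq0 (Subtype.ext h), ((hQU q).1 hq).1, ((hQU q).1 hq).2⟩
  have hX₀j : Module.finrank ℂ (Um.map X₀) = 8 := by
    rcases hprof X₀ hX₀ hΘX₀ hX₀Θ hX₀c with ⟨hi0, -⟩ | ⟨-, hj8⟩
    · exfalso
      have hmem : X₀ c ∈ Up.map X₀ := Submodule.mem_map_of_mem ((hUp c).2 hιc)
      rw [Submodule.finrank_eq_zero.1 hi0, Submodule.mem_bot] at hmem
      exact hX₀c0 hmem
    · exact hj8
  obtain ⟨hxmem, hιmx, hxιm, hxrk⟩ := UnitaryLeviSetup.restrict_mem hcm hLm hιmapply X₀ hX₀ hΘX₀ hX₀Θ hX₀c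
  rw [hX₀j] at hxrk
  refine UnitaryConstantRank.false_of_le_rank hbrLm hirrLm hιmmem hιmιm hPm hQm (s := fun v w : Um => s (v : W) w)
    (hsU Um) (fun v w => hsymm v w) hPmQm hdefPm hdefQm hadjLm hxmem hιmx hxιm (by rw [hxrk]; omega)
    (by rw [hxrk]; omega) fun A hA hιA hAι hAne => ?_
  obtain ⟨X, hX, hΘX, hXΘ, hXc, hXUm⟩ := UnitaryLeviSetup.exists_lift hbr hΘ hΘΘ hcm hιΘ hLm hιmapply A hA hιA hAι
  rcases hprof X hX hΘX hXΘ hXc with ⟨-, hj0⟩ | ⟨-, hj8⟩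
  · exfalso
    rw [hj0] at hXUm
    exact hAne (LinearMap.range_eq_bot.1 (Submodule.finrank_eq_zero.1 hXUm.symm))
  · rw [hxrk, ← hXUm, hj8]

/-- **The `(12 | 19)` core REDUCED to constant rank `9` — UNCONDITIONAL, partial.** In the unitary setting with
`dim P = 12`, `dim Q = 19`: if `𝔊` contains a non-zero raising operator of rank `≠ 9`, then `𝔊 = End(W)`.
(Equivalently: a proper irreducible unitary `Θ`-subalgebra of type `(12 | 19)` has all its non-zero raising operators
of rank exactly `9`.) See the module docstring. [cite: Ribet1983, Thm. 3] [cite: Gordon1997, Thm. 6.3 (3)]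
[cite: Deligne1982HodgeCycles, I §3 Prop. 3.4, 3.6] [cite: GoodmanWallachGTM255, §4.1.1] -/
theorem UnitaryTwelveNineteen.eq_top_of_smul_of_rank_ne_nine [FiniteDimensional ℂ W]
    {𝔊 : Submodule ℂ (Module.End ℂ W)}
    (hbr : ∀ Y ∈ 𝔊, ∀ Z ∈ 𝔊, Y * Z - Z * Y ∈ 𝔊)
    (hirr : ∀ U : Submodule ℂ W, (∀ A ∈ 𝔊, ∀ u ∈ U, A u ∈ U) → U = ⊥ ∨ U = ⊤)
    {Θ : Module.End ℂ W} (hΘ : Θ ∈ 𝔊) (hΘΘ : Θ * Θ = 1)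
    {P Q : Submodule ℂ W} (hP : ∀ x, x ∈ P ↔ Θ x = x) (hQ : ∀ x, x ∈ Q ↔ Θ x = -x)
    (hP12 : Module.finrank ℂ P = 12) (hQ19 : Module.finrank ℂ Q = 19)
    {s : W → W → ℂ} (hadd : ∀ x y z, s (x + y) z = s x z + s y z)
    (hsmul : ∀ (c : ℂ) (x y : W), s (c • x) y = c * s x y) (hsymm : ∀ x y, s y x = starRingEnd ℂ (s x y))
    (hPQ : ∀ p ∈ P, ∀ q ∈ Q, s p q = 0) (hdefP : ∀ p ∈ P, s p p = 0 → p = 0) (hdefQ : ∀ q ∈ Q, s q q = 0 → q = 0)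
    (hadj : ∀ X ∈ 𝔊, ∃ Y ∈ 𝔊, ∀ x y, s (X x) y = s x (Y y))
    {B : Module.End ℂ W} (hB : B ∈ 𝔊) (hΘB : Θ * B = B) (hBΘ : B * Θ = -B) (hB0 : B ≠ 0)
    (hB9 : Module.finrank ℂ (LinearMap.range B) ≠ 9) : 𝔊 = ⊤ := by
  classical
  have hraiseval : ∀ Z : Module.End ℂ W, Θ * Z = Z → ∀ w, Z w ∈ P := fun Z hΘZ w =>
    (hP _).2 (by rw [← Module.End.mul_apply, hΘZ])
  have hle12 : ∀ B' : Module.End ℂ W, Θ * B' = B' → Module.finrank ℂ (LinearMap.range B') ≤ 12 := fun B' h => by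
    rw [← hP12]
    exact Submodule.finrank_mono (by rintro _ ⟨w, rfl⟩; exact hraiseval B' h w)
  have hsU : ∀ U : Submodule ℂ W, ∀ x y z : U, s ((x + y : U) : W) z = s (x : W) z + s (y : W) z :=
    fun U x y z => by simp only [Submodule.coe_add, hadd]
  have hsmU : ∀ U : Submodule ℂ W, ∀ (c : ℂ) (x y : U), s ((c • x : U) : W) y = c * s (x : W) y :=
    fun U c x y => by simp only [Submodule.coe_smul, hsmul]
  -- STEP 1: the good ranks `1, …, 8, 11, 12`
  have key : ∀ B' ∈ 𝔊, Θ * B' = B' → B' * Θ = -B' → 1 ≤ Module.finrank ℂ (LinearMap.range B') →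
      Module.finrank ℂ (LinearMap.range B') ≠ 9 → Module.finrank ℂ (LinearMap.range B') ≠ 10 → 𝔊 = ⊤ := by
    intro B' hB' hΘB' hB'Θ hr1 hr9 hr10
    have h12 := hle12 B' hΘB'
    refine UnitaryDoubleLevi.eq_top_of_raise_of_core hbr hirr hΘ hΘΘ hP hQ hadd hsymm hPQ hdefP hdefQ hadj hB' hΘB' hB'Θ
      (by omega) (by omega) (by omega)
      fun U 𝔩 ι P' Q' hbr𝔩 hirr𝔩 hι hιι hP' hQ' hfinP' hfinQ' hP'Q' hdefP' hdefQ' hadj𝔩 => ?_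
    rw [hQ19] at hfinQ'
    have hr : Module.finrank ℂ (LinearMap.range B') = 1 ∨ Module.finrank ℂ (LinearMap.range B') = 2 ∨
        Module.finrank ℂ (LinearMap.range B') = 3 ∨ Module.finrank ℂ (LinearMap.range B') = 4 ∨
        Module.finrank ℂ (LinearMap.range B') = 5 ∨ Module.finrank ℂ (LinearMap.range B') = 6 ∨
        Module.finrank ℂ (LinearMap.range B') = 7 ∨ Module.finrank ℂ (LinearMap.range B') = 8 ∨
        Module.finrank ℂ (LinearMap.range B') = 11 ∨ Module.finrank ℂ (LinearMap.range B') = 12 := by omega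
    rcases hr with h | h | h | h | h | h | h | h | h | h <;> rw [h] at hfinP' hfinQ'
    · -- `(1 | 18)`: the `(m, 1)` core for `−ι`
      exact UnitaryThreeCoprime.eq_top_of_finrank_eq_one hbr𝔩 hirr𝔩 (Submodule.neg_mem _ hι)
        ((neg_mul_neg ι ι).trans hιι) (P := Q') (Q := P') (fun x => by rw [hQ', LinearMap.neg_apply, neg_eq_iff_eq_neg])
        (fun x => by rw [hP', LinearMap.neg_apply, neg_inj]) (by omega) hfinP'
    · -- `(2 | 17)`
      exact UnitaryTwoOdd.eq_top hbr𝔩 hirr𝔩 hι hιι hP' hQ' hfinP' ⟨8, by omega⟩ (s := fun x y : U => s (x : W) y)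
        (hsU U) (fun x y => hsymm x y) hP'Q' hdefP' hdefQ' hadj𝔩
    · -- `(3 | 16)`
      exact UnitaryThreeCoprime.eq_top hbr𝔩 hirr𝔩 hι hιι hP' hQ' hfinP' (by omega) (s := fun x y : U => s (x : W) y)
        (hsU U) (fun x y => hsymm x y) hP'Q' hdefP' hdefQ' hadj𝔩
    · -- `(4 | 15)`
      exact UnitaryFourOdd.eq_top hbr𝔩 hirr𝔩 hι hιι hP' hQ' hfinP' ⟨7, by omega⟩ (s := fun x y : U => s (x : W) y)
        (hsU U) (fun x y => hsymm x y) hP'Q' hdefP' hdefQ' hadj𝔩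
    · -- `(5 | 14)`
      exact UnitaryFive.eq_top hbr𝔩 hirr𝔩 hι hιι hP' hQ' hfinP' (Or.inr (by omega)) (s := fun x y : U => s (x : W) y)
        (hsU U) (fun x y => hsymm x y) hP'Q' hdefP' hdefQ' hadj𝔩
    · -- `(6 | 13)`
      exact UnitarySix.eq_top_of_smul hbr𝔩 hirr𝔩 hι hιι hP' hQ' hfinP' ⟨6, by omega⟩ (by omega)
        (s := fun x y : U => s (x : W) y) (hsU U) (hsmU U) (fun x y => hsymm x y) hP'Q' hdefP' hdefQ' hadj𝔩
    · -- `(7 | 12)`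
      exact UnitarySeven.eq_top_of_smul hbr𝔩 hirr𝔩 hι hιι hP' hQ' hfinP' (by omega) (s := fun x y : U => s (x : W) y)
        (hsU U) (hsmU U) (fun x y => hsymm x y) hP'Q' hdefP' hdefQ' hadj𝔩
    · -- `(8 | 11)`
      exact UnitaryEight.eq_top_of_smul hbr𝔩 hirr𝔩 hι hιι hP' hQ' hfinP' ⟨5, by omega⟩ (by omega) (by omega)
        (s := fun x y : U => s (x : W) y) (hsU U) (hsmU U) (fun x y => hsymm x y) hP'Q' hdefP' hdefQ' hadj𝔩
    · -- `(11 | 8)`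
      exact UnitaryEight.eq_top_of_smul' hbr𝔩 hirr𝔩 hι hιι hP' hQ' ⟨5, by omega⟩ (by omega) (by omega) (by omega)
        (s := fun x y : U => s (x : W) y) (hsU U) (hsmU U) (fun x y => hsymm x y) hP'Q' hdefP' hdefQ' hadj𝔩
    · -- `(12 | 7)`
      exact UnitarySeven.eq_top_of_smul' hbr𝔩 hirr𝔩 hι hιι hP' hQ' (by omega) (by omega)
        (s := fun x y : U => s (x : W) y) (hsU U) (hsmU U) (fun x y => hsymm x y) hP'Q' hdefP' hdefQ' hadj𝔩
  -- STEP 2: otherwise every raising operator has rank in `{0, 9, 10}`, and `10` is excluded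
  by_contra hne
  have hbad : ∀ B' ∈ 𝔊, Θ * B' = B' → B' * Θ = -B' →
      Module.finrank ℂ (LinearMap.range B') = 0 ∨ Module.finrank ℂ (LinearMap.range B') = 9 ∨
        Module.finrank ℂ (LinearMap.range B') = 10 := by
    intro B' hB' hΘB' hB'Θ
    by_cases h0 : Module.finrank ℂ (LinearMap.range B') = 0
    · exact Or.inl h0
    by_cases h9 : Module.finrank ℂ (LinearMap.range B') = 9
    · exact Or.inr (Or.inl h9)
    by_cases h10 : Module.finrank ℂ (LinearMap.range B') = 10
    · exact Or.inr (Or.inr h10)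
    exact absurd (key B' hB' hΘB' hB'Θ (by omega) h9 h10) hne
  have hno10 : ∀ B' ∈ 𝔊, Θ * B' = B' → B' * Θ = -B' → Module.finrank ℂ (LinearMap.range B') ≠ 10 :=
    fun B' hB' hΘB' hB'Θ h10 => UnitaryTwelveNineteen.no_rank_ten hbr hirr hΘ hΘΘ hP hQ hP12 hQ19 hadd hsymm hPQ hdefP
      hdefQ hadj hbad hB' hΘB' hB'Θ h10
  rcases hbad B hB hΘB hBΘ with h | h | h
  · exact hB0 (LinearMap.range_eq_bot.1 (Submodule.finrank_eq_zero.1 h))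
  · exact hB9 h
  · exact hno10 B hB hΘB hBΘ h

/-- **The mirror `(19, 12)`** (apply `eq_top_of_smul_of_rank_ne_nine` to `−Θ`; a raising operator of `−Θ` is a
lowering operator of `Θ`). [cite: Ribet1983, Thm. 3] [cite: Gordon1997, Thm. 6.3 (3)] -/
theorem UnitaryTwelveNineteen.eq_top_of_smul_of_rank_ne_nine' [FiniteDimensional ℂ W]
    {𝔊 : Submodule ℂ (Module.End ℂ W)}
    (hbr : ∀ Y ∈ 𝔊, ∀ Z ∈ 𝔊, Y * Z - Z * Y ∈ 𝔊)
    (hirr : ∀ U : Submodule ℂ W, (∀ A ∈ 𝔊, ∀ u ∈ U, A u ∈ U) → U = ⊥ ∨ U = ⊤)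
    {Θ : Module.End ℂ W} (hΘ : Θ ∈ 𝔊) (hΘΘ : Θ * Θ = 1)
    {P Q : Submodule ℂ W} (hP : ∀ x, x ∈ P ↔ Θ x = x) (hQ : ∀ x, x ∈ Q ↔ Θ x = -x)
    (hP19 : Module.finrank ℂ P = 19) (hQ12 : Module.finrank ℂ Q = 12)
    {s : W → W → ℂ} (hadd : ∀ x y z, s (x + y) z = s x z + s y z)
    (hsmul : ∀ (c : ℂ) (x y : W), s (c • x) y = c * s x y) (hsymm : ∀ x y, s y x = starRingEnd ℂ (s x y))
    (hPQ : ∀ p ∈ P, ∀ q ∈ Q, s p q = 0) (hdefP : ∀ p ∈ P, s p p = 0 → p = 0) (hdefQ : ∀ q ∈ Q, s q q = 0 → q = 0)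
    (hadj : ∀ X ∈ 𝔊, ∃ Y ∈ 𝔊, ∀ x y, s (X x) y = s x (Y y))
    {C : Module.End ℂ W} (hC : C ∈ 𝔊) (hΘC : Θ * C = -C) (hCΘ : C * Θ = C) (hC0 : C ≠ 0)
    (hC9 : Module.finrank ℂ (LinearMap.range C) ≠ 9) : 𝔊 = ⊤ := by
  have hnΘ : -Θ ∈ 𝔊 := Submodule.neg_mem _ hΘ
  have hnΘΘ : (-Θ) * (-Θ) = 1 := by rw [neg_mul_neg, hΘΘ]
  exact UnitaryTwelveNineteen.eq_top_of_smul_of_rank_ne_nine hbr hirr hnΘ hnΘΘ (P := Q) (Q := P)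
    (fun x => by rw [hQ, LinearMap.neg_apply, neg_eq_iff_eq_neg]) (fun x => by rw [hP, LinearMap.neg_apply, neg_inj])
    hQ12 hP19 hadd hsmul hsymm (fun p hp q hq => by rw [hsymm, hPQ q hq p hp, map_zero]) hdefQ hdefP hadj hC
    (by rw [neg_mul, hΘC, neg_neg]) (by rw [mul_neg, hCΘ]) hC0 hC9

end HodgeStructure

end Literature.AlgebraicGeometry.Motives

end
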